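import Summits.CriticalPhenomena.SAWScalingLimit.Theses.SAWRenewalTightness
import Summits.CriticalPhenomena.SAWScalingLimit.Theses.SAWRestrictionRigidity
import Summits.CriticalPhenomena.SAWScalingLimit.Theses.SAWWeldingIdentification
import Summits.CriticalPhenomena.SAWScalingLimit.Theorems.SAWRenewalTightnessTightOfShellCrossing
import Summits.CriticalPhenomena.SAWScalingLimit.Theorems.SAWRenewalTightnessShellCrossingBoundTravCount
import Summits.CriticalPhenomena.SAWScalingLimit.Theorems.SAWRenewalTightnessShellCrossingBoundOfPinchAway
import Summits.CriticalPhenomena.SAWScalingLimit.Theorems.SAWRenewalTightnessEventualTightOfBoundedVirginArc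
import Summits.CriticalPhenomena.SAWScalingLimit.Theorems.SAWRenewalTightnessEventualTightSketchDefs
import Summits.CriticalPhenomena.SAWScalingLimit.Theorems.SAWTotalPositivityTPToTraversalBoundBoundaryShellsAux
import Summits.CriticalPhenomena.SAWScalingLimit.Theorems.BulkShellTight.Negative.OfEventualTight

/-!
# Line `boundary_bulk` — an E-free skeleton for the crux `EventualTight` (stmt-CriticalPhenomena-1372)

Strategist s4 (unit `cstrat-stmt-CriticalPhenomena-1372-s4`, 2026-08-17).  Registered ALONGSIDE the lead's line
`Lines/Sketch.lean` (v12: open stubs X2c₁ᵇ `stub_virginArcTraversalTightBounded` = stmt-18042 and E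
`stub_confinementPositivity` = stmt-17587); it does not touch that skeleton.

## Idea

The crux is (landed criterion `TightOfShellCrossing_proof` + AB99 dress) the statement that for every `(D, a, b)` the
number of separate traversals of the genuine shells `D(x; ρ, R)`, `R ≤ 1`, by the critical SAW polyline obeys a uniform
power law with a shell-dependent threshold; for that it suffices to have PER-SHELL COUNT TIGHTNESS on the FAT shells
`14ρ ≤ R ≤ 1` only (`shellCrossing_of_fatShellDecay` below: thin shells are free, `K = 14³`, coarse meshes by the landed
count `Theorems.stub_travCount`).  Split the fat shells by WHERE they sit, along the fault line the standing disproof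
exhibits (`Cruxes/EventualTight/Disproof.lean` §5, `eventualTight_false_without_jordan`: without the Jordan loop a FIXED
shell at an accumulation point of `∂Ω` is traversed `K δ / 2 → ∞` times — a purely BOUNDARY failure):

* `closedBall x (2ρ) ⊆ Ω` (BULK): thinning the shell to `D(x; ρ, R')`, `R' = min R (ρ + ε'/2)` with
  `closedBall x (2R') ⊆ Ω` (compactness, `Ω` open: `IsCompact.exists_cthickening_subset_open`, `cthickening_closedBall`)
  only ENLARGES the event (`Curve.HasTraversals.mono'`), and the thin interior shell is closed by the bulk atom X2c₁ᵇ
  through the landed chain V4 + rung B + aspect reduction A (`Theorems.bulkShellTight_of_virginArcTraversalTightBounded`,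
  p151500) — NO restriction positivity E, no enlargement of the domain;
* otherwise (BOUNDARY): either the inner ball misses `Ω̄` (no traversal at all, `not_hasTraversals_of_disjoint`) or there
  is a FRONTIER point `y` with `dist x y ≤ 2ρ` (`exists_mem_frontier_infDist_compl_eq_dist` /
  `exists_mem_frontier_dist_le`), and `k` traversals of `D(x; ρ, R)` are `k` traversals of the frontier-centred shell
  `D(y; 3ρ, R − 2ρ)` of aspect `≥ 4` (`Curve.HasTraversals.mono`; this is where `14ρ ≤ R` is used) — closed by the NEW
  stub `stub_boundaryShellTight` (filed as route item stmt-CriticalPhenomena-19311 `SAWRenewalTightness.BoundaryShellTight`,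
  crux rank 3, route file rev 5 — same body), which is BY NAME (`Iff.rfl`, `stub_boundaryShellTight_iff_radial`) the open content
  `Theorems.TPToTraversalBound.Radial.BoundaryShellTight` already isolated on the route SAWTotalPositivity (crux
  stmt-10687, line `radial-portal-transfer` rev 4): per-domain, per-shell count tightness of frontier-centred shells,
  where the Jordan loop must be spent (`jordan_boundary_finitely_many_traversals` bounds the FORCED traversals; the
  content is the bound on the UNFORCED ones = Kemppainen–Smirnov Condition G2/C2 at boundary annuli, count form).

So ONE open boundary statement now serves two cruxes (1372 here, 10687 there), and on THIS crux it replaces E: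
compared with the split of record {X2c₁ᵇ, E}, E (`ConfinementPositivity`) is a LOWER bound on a restriction probability
(immune to the multivalued-map / unfolding principle behind every known `x_c`-SAW estimate on `ℤ²`), whereas both stubs
here are UPPER bounds on the probability of a locally over-dense feature; the new pair is implied by the old one
(`boundaryShellTight_of_virginArcTraversalTightBounded_of_confinementPositivity`) and the new stub by the crux itself
(`boundaryShellTight_of_eventualTight`), so it adds no refutation risk; indeed the crux is EQUIVALENT to
`BulkShellTight ∧ BoundaryShellTight` (`eventualTight_iff_bulkShellTight_and_boundaryShellTight`: an exact, rate-free
bulk/boundary decomposition of stmt-1372, E-free).  It does NOT make X2c₁ᵇ (stmt-18042) easier — that stub is shared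
verbatim with `Lines/Sketch.lean`.

`lean check`: sorries = 2 (the two `stub_*`); `EventualTight_of`, the wiring theorems and the certificates have none.
-/

namespace Summit.CriticalPhenomena.SAWScalingLimit.Cruxes.EventualTight.BoundaryBulk

open MeasureTheory Set Metric
open scoped ENNReal
open Literature.Probability.RandomPlanarGeometry Literature.Probability.LatticeModels
open Summit.CriticalPhenomena.SAWScalingLimit.Theses.SAWRenewalTightness
open Summit.CriticalPhenomena.SAWScalingLimit.Theorems.TPToTraversalBound (Radial.not_hasTraversals_of_disjoint
  Radial.exists_mem_frontier_dist_le Radial.law_le_bound_of_le_mul)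

/-! ### The two registered stubs -/

/-- **X2c₁ᵇ `stub_virginArcTraversalTightBounded`** — item stmt-CriticalPhenomena-18042, VERBATIM the registered open stub
of `Lines/Sketch.lean` (same name, same signature; one proof of the item discharges both).  The bulk atom: a
uniform-in-exterior multi-crossing bound for the critical `ℤ²` self-avoiding arc measure across ONE interior lattice
annulus `D(z₀; 2N/5, 3N/5)` of a virgin disc inside a finite planar graph confined to `B̄(z₀, C·N)`.  No tool known
(no FKG/RSW, no `ℤ²` observable). [conjecture-grade] -/
theorem stub_virginArcTraversalTightBounded :
    ∀ C θ : ℝ, 0 < θ →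
      ∃ (k : ℕ) (N₀ : ℝ), 0 < N₀ ∧
        ∀ (H : SimpleGraph (Site 2)) (Λ : Set (Site 2)) (z₀ : ℂ) (N : ℝ) (u c u' c' : Site 2),
          Λ.Finite → (∀ v ∈ Λ, dist (Site.toComplex v) z₀ ≤ C * N) → N₀ ≤ N →
          (H ≤ zdGraph 2 ∧ (∀ v : Site 2, dist (Site.toComplex v) z₀ ≤ N → v ∈ Λ) ∧
            ∀ v v' : Site 2, dist (Site.toComplex v) z₀ ≤ N + 1 →
              dist (Site.toComplex v') z₀ ≤ N + 1 → (zdGraph 2).Adj v v' → H.Adj v v') →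
          (H.Adj u c ∧ u ∉ Λ ∧ c ∈ Λ ∧ dist (Site.toComplex c) z₀ ≤ N ∧
            N < dist (Site.toComplex u) z₀) →
          (H.Adj u' c' ∧ u' ∉ Λ ∧ c' ∈ Λ ∧ dist (Site.toComplex c') z₀ ≤ N ∧
            N < dist (Site.toComplex u') z₀) →
          ∑' p : {p : {p : H.Walk c c' // p.IsPath ∧ ∀ v ∈ p.support, v ∈ Λ} //
              ∃ ι κ : Fin k → Fin (p.1.support.map Site.toComplex).length, (∀ m, ι m ≤ κ m) ∧
                (∀ m, (dist ((p.1.support.map Site.toComplex).get (ι m)) z₀ ≤ 2 * N / 5 ∧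
                    3 * N / 5 ≤ dist ((p.1.support.map Site.toComplex).get (κ m)) z₀) ∨
                  (3 * N / 5 ≤ dist ((p.1.support.map Site.toComplex).get (ι m)) z₀ ∧
                    dist ((p.1.support.map Site.toComplex).get (κ m)) z₀ ≤ 2 * N / 5)) ∧
                ∀ ⦃m m'⦄, m < m' → κ m ≤ ι m'},
              ENNReal.ofReal (SAW.criticalFugacity ^ p.1.1.length) ≤
            ENNReal.ofReal θ *
              ∑' p : {p : H.Walk c c' // p.IsPath ∧ ∀ v ∈ p.support, v ∈ Λ},
                ENNReal.ofReal (SAW.criticalFugacity ^ p.1.length) := by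
  sorry

/-- **B `stub_boundaryShellTight`** (NEW on this crux, OPEN) — by name `Theorems.TPToTraversalBound.Radial.BoundaryShellTight`
(`stub_boundaryShellTight_iff_radial`): for every Dobrushin domain `(D; a, b)` with an endpoint approximation and every
SINGLE shell `D(x; ρ, R)` centred ON the boundary curve (`x ∈ ∂D`), `0 < ρ`, `4ρ ≤ R ≤ 1`, and every `ε > 0` there are a
traversal number `k` and a mesh bound `δ₀ > 0` (both depending on `D, a, b` AND the shell — `not_cruxUniformThreshold`)
with `P[≥ k separate traversals] ≤ ε` for `δ ∈ (0, δ₀]`.  No rate, no uniformity in the shell.  The Jordan loop of `D` is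
load-bearing here and only here (`eventualTight_false_without_jordan`); implied by the crux
(`boundaryShellTight_of_eventualTight`). [conjecture-grade] -/
theorem stub_boundaryShellTight :
    ∀ (D : DobrushinDomain) (a b : ℝ → Site 2), SAW.IsEndpointApprox D a b →
      ∀ (x : ℂ) (ρ R : ℝ), x ∈ frontier D.carrier → 0 < ρ → 4 * ρ ≤ R → R ≤ 1 → ∀ ε : ℝ, 0 < ε →
        ∃ (k : ℕ) (δ₀ : ℝ), 0 < δ₀ ∧ ∀ δ ∈ Set.Ioc (0 : ℝ) δ₀,
          SAW.law D.carrier δ (a δ) (b δ)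
            {γ | (⟨γ.walk.toCurve (meshPoint δ)⟩ : Curve ℂ).HasTraversals k x ρ R} ≤ ENNReal.ofReal ε := by
  sorry

/-- The boundary stub IS the TotalPositivity route's isolated open content, by name. [folklore] -/
theorem stub_boundaryShellTight_iff_radial :
    (∀ (D : DobrushinDomain) (a b : ℝ → Site 2), SAW.IsEndpointApprox D a b →
      ∀ (x : ℂ) (ρ R : ℝ), x ∈ frontier D.carrier → 0 < ρ → 4 * ρ ≤ R → R ≤ 1 → ∀ ε : ℝ, 0 < ε →
        ∃ (k : ℕ) (δ₀ : ℝ), 0 < δ₀ ∧ ∀ δ ∈ Set.Ioc (0 : ℝ) δ₀,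
          SAW.law D.carrier δ (a δ) (b δ)
            {γ | (⟨γ.walk.toCurve (meshPoint δ)⟩ : Curve ℂ).HasTraversals k x ρ R} ≤ ENNReal.ofReal ε) ↔
    Summit.CriticalPhenomena.SAWScalingLimit.Theorems.TPToTraversalBound.Radial.BoundaryShellTight :=
  Iff.rfl

/-! ### The glue (sorry-free) -/

/-- **Fat-shell count tightness from the bulk/boundary dichotomy.**  For a fat shell `D(x; ρ, R)`, `14ρ ≤ R ≤ 1`:
if `closedBall x (2ρ) ⊆ Ω`, thin it to an interior shell `D(x; ρ, R')` with `closedBall x (2R') ⊆ Ω` and use the bulk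
statement; else, unless the inner ball misses `Ω̄` (empty event), re-centre at a frontier point within `2ρ` to the
frontier-centred shell `D(y; 3ρ, R − 2ρ)` of aspect `≥ 4` and use the boundary statement. [folklore glue] -/
theorem fatShellTight_of_bulk_of_boundary
    (hBulk : ∀ (D : DobrushinDomain) (a b : ℝ → Site 2), SAW.IsEndpointApprox D a b →
      ∀ (y : ℂ) (η R : ℝ), 0 < η → η < R → Metric.closedBall y (2 * R) ⊆ D.carrier →
        ∀ ε : ℝ, 0 < ε → ∃ (j : ℕ) (δ₁ : ℝ), 0 < δ₁ ∧ ∀ δ ∈ Set.Ioc (0 : ℝ) δ₁,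
          SAW.law D.carrier δ (a δ) (b δ)
            {γ | (⟨γ.walk.toCurve (meshPoint δ)⟩ : Curve ℂ).HasTraversals j y η R} ≤ ENNReal.ofReal ε)
    (hBdry : ∀ (D : DobrushinDomain) (a b : ℝ → Site 2), SAW.IsEndpointApprox D a b →
      ∀ (x : ℂ) (ρ R : ℝ), x ∈ frontier D.carrier → 0 < ρ → 4 * ρ ≤ R → R ≤ 1 → ∀ ε : ℝ, 0 < ε →
        ∃ (k : ℕ) (δ₀ : ℝ), 0 < δ₀ ∧ ∀ δ ∈ Set.Ioc (0 : ℝ) δ₀,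
          SAW.law D.carrier δ (a δ) (b δ)
            {γ | (⟨γ.walk.toCurve (meshPoint δ)⟩ : Curve ℂ).HasTraversals k x ρ R} ≤ ENNReal.ofReal ε)
    (D : DobrushinDomain) (a b : ℝ → Site 2) (hab : SAW.IsEndpointApprox D a b) :
    ∀ (x : ℂ) (ρ R : ℝ), 0 < ρ → 14 * ρ ≤ R → R ≤ 1 → ∀ ε : ℝ, 0 < ε → ∃ (k : ℕ) (δ₁ : ℝ), 0 < δ₁ ∧
      ∀ δ ∈ Set.Ioc (0 : ℝ) δ₁,
        SAW.law D.carrier δ (a δ) (b δ)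
          {γ | (⟨γ.walk.toCurve (meshPoint δ)⟩ : Curve ℂ).HasTraversals k x ρ R} ≤ ENNReal.ofReal ε := by
  intro x ρ R hρ h14 hR1 ε hε
  have hρR : ρ < R := by linarith
  by_cases hin : Metric.closedBall x (2 * ρ) ⊆ D.carrier
  · -- BULK: thin the shell inside the domain
    obtain ⟨ε', hε', hsub⟩ :=
      (isCompact_closedBall x (2 * ρ)).exists_cthickening_subset_open D.isOpen hin
    rw [cthickening_closedBall hε'.le (by positivity)] at hsub
    set R' : ℝ := min R (ρ + ε' / 2) with hR'def
    have hρR' : ρ < R' := lt_min hρR (by linarith)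
    have hR'R : R' ≤ R := min_le_left _ _
    have h2R' : Metric.closedBall x (2 * R') ⊆ D.carrier := by
      refine subset_trans (Metric.closedBall_subset_closedBall ?_) hsub
      have : R' ≤ ρ + ε' / 2 := min_le_right _ _
      linarith
    obtain ⟨j, δ₁, hδ₁, hj⟩ := hBulk D a b hab x ρ R' hρ hρR' h2R' ε hε
    refine ⟨j, δ₁, hδ₁, fun δ hδ => le_trans (measure_mono fun γ hγ => ?_) (hj δ hδ)⟩
    exact Curve.HasTraversals.mono' hγ le_rfl hR'R
  · -- BOUNDARY: a point of the complement within `2ρ` of the centre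
    obtain ⟨z, hzx, hzD⟩ := Set.not_subset.1 hin
    rw [Metric.mem_closedBall] at hzx
    by_cases hfar : Disjoint (Metric.closedBall x ρ) (closure D.carrier)
    · -- far shell: never traversed
      refine ⟨1, 1, one_pos, fun δ hδ => ?_⟩
      have h0 : SAW.law D.carrier δ (a δ) (b δ)
          {γ | (⟨γ.walk.toCurve (meshPoint δ)⟩ : Curve ℂ).HasTraversals 1 x ρ R} = 0 :=
        measure_mono_null (fun γ hγ => Radial.not_hasTraversals_of_disjoint γ hfar one_ne_zero hρR hγ)
          measure_empty
      rw [h0]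
      exact bot_le
    · -- a frontier point within `2ρ`
      obtain ⟨y, hyf, hyd⟩ : ∃ y ∈ frontier D.carrier, dist x y ≤ 2 * ρ := by
        by_cases hxD : x ∈ D.carrier
        · obtain ⟨y, hyf, hyd⟩ :=
            exists_mem_frontier_infDist_compl_eq_dist hxD D.toJordanDomain.carrier_ne_univ
          refine ⟨y, hyf, ?_⟩
          rw [← hyd]
          calc Metric.infDist x D.carrierᶜ ≤ dist x z := Metric.infDist_le_dist_of_mem hzD
            _ ≤ 2 * ρ := by rwa [dist_comm]
        · obtain ⟨y, hyf, hyd⟩ :=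
            Radial.exists_mem_frontier_dist_le D.isOpen hxD (Set.not_disjoint_iff_nonempty_inter.1 hfar)
          exact ⟨y, hyf, hyd.trans (by linarith)⟩
      -- re-centre: traversals of `D(x; ρ, R)` are traversals of `D(y; 3ρ, R - 2ρ)`, aspect `≥ 4`
      obtain ⟨k, δ₀, hδ₀, hk⟩ :=
        hBdry D a b hab y (3 * ρ) (R - 2 * ρ) hyf (by positivity) (by linarith) (by linarith) ε hε
      refine ⟨k, δ₀, hδ₀, fun δ hδ => le_trans (measure_mono fun γ hγ => ?_) (hk δ hδ)⟩
      exact Curve.HasTraversals.mono hγ (by linarith) (by linarith)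

/-- **Fat per-shell count tightness ⟹ the crux's bound** for one `(D, a, b)`, with `K = 14³`, `λ = 3` and the GLOBAL
mesh threshold `δ₀ = 1` (the fat-only variant of the landed `Theorems.shellCrossing_of_perShellDecay`): for a fat shell
`14ρ ≤ R ≤ 1` take `ε = (ρ/R)³`, the `k₁, δ₁` of per-shell tightness and the `N` of the landed coarse-mesh count
`Theorems.stub_travCount` at `(ρ, δ₁)`; the threshold `max k₁ N` works for `δ ≤ δ₁` by monotonicity in `k` and for
`δ > δ₁` because the event is empty; THIN shells `R < 14ρ` are free (`law_le_bound_of_le_mul`: `14³ (ρ/R)³ ≥ 1`).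
[folklore glue] -/
theorem shellCrossing_of_fatShellDecay (D : DobrushinDomain) (a b : ℝ → Site 2)
    (hP : ∀ (x : ℂ) (ρ R : ℝ), 0 < ρ → 14 * ρ ≤ R → R ≤ 1 → ∀ ε : ℝ, 0 < ε → ∃ (k : ℕ) (δ₁ : ℝ), 0 < δ₁ ∧
      ∀ δ ∈ Set.Ioc (0 : ℝ) δ₁,
        SAW.law D.carrier δ (a δ) (b δ)
          {γ | (⟨γ.walk.toCurve (meshPoint δ)⟩ : Curve ℂ).HasTraversals k x ρ R} ≤ ENNReal.ofReal ε) :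
    ∃ (k : ℂ → ℝ → ℝ → ℕ) (K lam δ₀ : ℝ), 2 < lam ∧ 0 < δ₀ ∧ ∀ δ ∈ Set.Ioc (0 : ℝ) δ₀,
      ∀ (x : ℂ) (ρ R : ℝ), δ ≤ ρ → ρ < R → R ≤ 1 →
        SAW.law D.carrier δ (a δ) (b δ)
            {γ | (⟨γ.walk.toCurve (meshPoint δ)⟩ : Curve ℂ).HasTraversals (k x ρ R) x ρ R} ≤
          ENNReal.ofReal (K * (ρ / R) ^ lam) := by
  classical
  have key : ∀ (x : ℂ) (ρ R : ℝ), ∃ k : ℕ, 0 < ρ → ρ < R → R ≤ 1 → ∀ δ ∈ Set.Ioc (0 : ℝ) 1,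
      SAW.law D.carrier δ (a δ) (b δ)
          {γ | (⟨γ.walk.toCurve (meshPoint δ)⟩ : Curve ℂ).HasTraversals k x ρ R} ≤
        ENNReal.ofReal ((14 : ℝ) ^ (3 : ℝ) * (ρ / R) ^ (3 : ℝ)) := by
    intro x ρ R
    by_cases h : 0 < ρ ∧ 14 * ρ ≤ R ∧ R ≤ 1
    · obtain ⟨hρ, h14, hR1⟩ := h
      have hρR : ρ < R := by linarith
      have hε : 0 < (ρ / R) ^ (3 : ℝ) := Real.rpow_pos_of_pos (div_pos hρ (hρ.trans hρR)) _
      have hKε : ENNReal.ofReal ((ρ / R) ^ (3 : ℝ)) ≤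
          ENNReal.ofReal ((14 : ℝ) ^ (3 : ℝ) * (ρ / R) ^ (3 : ℝ)) :=
        ENNReal.ofReal_le_ofReal
          (le_mul_of_one_le_left hε.le (Real.one_le_rpow (by norm_num) (by norm_num)))
      obtain ⟨k₁, δ₁, hδ₁, hk₁⟩ := hP x ρ R hρ h14 hR1 _ hε
      obtain ⟨N, hN⟩ := Theorems.stub_travCount ρ δ₁ hρ hδ₁
      refine ⟨max k₁ N, fun _ _ _ δ hδ => ?_⟩
      by_cases hle : δ ≤ δ₁
      · calc SAW.law D.carrier δ (a δ) (b δ)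
              {γ | (⟨γ.walk.toCurve (meshPoint δ)⟩ : Curve ℂ).HasTraversals (max k₁ N) x ρ R}
            ≤ SAW.law D.carrier δ (a δ) (b δ)
              {γ | (⟨γ.walk.toCurve (meshPoint δ)⟩ : Curve ℂ).HasTraversals k₁ x ρ R} :=
              measure_mono fun γ hγ => Curve.HasTraversals.of_le hγ (le_max_left _ _)
          _ ≤ ENNReal.ofReal ((ρ / R) ^ (3 : ℝ)) := hk₁ δ ⟨hδ.1, hle⟩
          _ ≤ _ := hKε
      · have hempty :
            {γ : SAW.DomainSAW D.carrier δ (a δ) (b δ) |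
              (⟨γ.walk.toCurve (meshPoint δ)⟩ : Curve ℂ).HasTraversals (max k₁ N) x ρ R} = ∅ :=
          Set.eq_empty_iff_forall_notMem.2 fun γ hγ =>
            hN D.carrier δ (a δ) (b δ) γ x R (le_of_lt (not_le.1 hle)) hρR
              (Curve.HasTraversals.of_le hγ (le_max_right _ _))
        rw [hempty, measure_empty]
        exact bot_le
    · -- thin (or degenerate) shell: the bound is at least `1`
      refine ⟨0, fun hρ hρR hR1 δ hδ => ?_⟩
      have h14 : R ≤ 14 * ρ := by
        by_contra hcon
        exact h ⟨hρ, le_of_lt (not_le.1 hcon), hR1⟩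
      exact Radial.law_le_bound_of_le_mul (by norm_num) (by norm_num) hρ (hρ.trans hρR) h14 le_rfl _
  choose k hk using key
  refine ⟨k, (14 : ℝ) ^ (3 : ℝ), 3, 1, by norm_num, one_pos, fun δ hδ x ρ R hδρ hρR hR1 => ?_⟩
  exact hk x ρ R (hδ.1.trans_le hδρ) hρR hR1 δ hδ

/-! ### The skeleton theorem: the stubs imply the crux, BY NAME -/

/-- **`EventualTight` from the line `boundary_bulk`** (kernel-checked, no `sorry` of its own): X2c₁ᵇ gives the bulk leaf
`BulkShellTight` (`Theorems.bulkShellTight_of_virginArcTraversalTightBounded`: V4 + rung B + aspect reduction, landed), the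
dichotomy glue `fatShellTight_of_bulk_of_boundary` adds the boundary stub to get per-shell count tightness at every FAT
shell, `shellCrossing_of_fatShellDecay` dresses it as `ShellCrossingBound` for that `(D, a, b)`, and the landed criterion
`Theorems.TightOfShellCrossing_proof` closes the crux.  Stated for the bet route's copy of the crux decl
(`SAWWeldingIdentification`, rev 10; body identical to the `SAWRenewalTightness` copy). -/
theorem EventualTight_of :
    (∀ C θ : ℝ, 0 < θ →
      ∃ (k : ℕ) (N₀ : ℝ), 0 < N₀ ∧
        ∀ (H : SimpleGraph (Site 2)) (Λ : Set (Site 2)) (z₀ : ℂ) (N : ℝ) (u c u' c' : Site 2),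
          Λ.Finite → (∀ v ∈ Λ, dist (Site.toComplex v) z₀ ≤ C * N) → N₀ ≤ N →
          (H ≤ zdGraph 2 ∧ (∀ v : Site 2, dist (Site.toComplex v) z₀ ≤ N → v ∈ Λ) ∧
            ∀ v v' : Site 2, dist (Site.toComplex v) z₀ ≤ N + 1 →
              dist (Site.toComplex v') z₀ ≤ N + 1 → (zdGraph 2).Adj v v' → H.Adj v v') →
          (H.Adj u c ∧ u ∉ Λ ∧ c ∈ Λ ∧ dist (Site.toComplex c) z₀ ≤ N ∧
            N < dist (Site.toComplex u) z₀) →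
          (H.Adj u' c' ∧ u' ∉ Λ ∧ c' ∈ Λ ∧ dist (Site.toComplex c') z₀ ≤ N ∧
            N < dist (Site.toComplex u') z₀) →
          ∑' p : {p : {p : H.Walk c c' // p.IsPath ∧ ∀ v ∈ p.support, v ∈ Λ} //
              ∃ ι κ : Fin k → Fin (p.1.support.map Site.toComplex).length, (∀ m, ι m ≤ κ m) ∧
                (∀ m, (dist ((p.1.support.map Site.toComplex).get (ι m)) z₀ ≤ 2 * N / 5 ∧
                    3 * N / 5 ≤ dist ((p.1.support.map Site.toComplex).get (κ m)) z₀) ∨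
                  (3 * N / 5 ≤ dist ((p.1.support.map Site.toComplex).get (ι m)) z₀ ∧
                    dist ((p.1.support.map Site.toComplex).get (κ m)) z₀ ≤ 2 * N / 5)) ∧
                ∀ ⦃m m'⦄, m < m' → κ m ≤ ι m'},
              ENNReal.ofReal (SAW.criticalFugacity ^ p.1.1.length) ≤
            ENNReal.ofReal θ *
              ∑' p : {p : H.Walk c c' // p.IsPath ∧ ∀ v ∈ p.support, v ∈ Λ},
                ENNReal.ofReal (SAW.criticalFugacity ^ p.1.length)) →
    (∀ (D : DobrushinDomain) (a b : ℝ → Site 2), SAW.IsEndpointApprox D a b →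
      ∀ (x : ℂ) (ρ R : ℝ), x ∈ frontier D.carrier → 0 < ρ → 4 * ρ ≤ R → R ≤ 1 → ∀ ε : ℝ, 0 < ε →
        ∃ (k : ℕ) (δ₀ : ℝ), 0 < δ₀ ∧ ∀ δ ∈ Set.Ioc (0 : ℝ) δ₀,
          SAW.law D.carrier δ (a δ) (b δ)
            {γ | (⟨γ.walk.toCurve (meshPoint δ)⟩ : Curve ℂ).HasTraversals k x ρ R} ≤ ENNReal.ofReal ε) →
    Summit.CriticalPhenomena.SAWScalingLimit.Theses.SAWWeldingIdentification.EventualTight :=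
  fun hXb hB =>
    Theorems.TightOfShellCrossing_proof fun D a b hab =>
      shellCrossing_of_fatShellDecay D a b
        (fatShellTight_of_bulk_of_boundary (Theorems.bulkShellTight_of_virginArcTraversalTightBounded hXb) hB D a b
          hab)

/-- **The crux proof modulo the stubs** (wiring check against the bet route's copy, `SAWWeldingIdentification`). -/
theorem EventualTight_proof_welding :
    Summit.CriticalPhenomena.SAWScalingLimit.Theses.SAWWeldingIdentification.EventualTight :=
  EventualTight_of stub_virginArcTraversalTightBounded stub_boundaryShellTight

/-- The same wiring check against the `SAWRenewalTightness` copy of the crux decl. -/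
theorem EventualTight_proof_renewal :
    Summit.CriticalPhenomena.SAWScalingLimit.Theses.SAWRenewalTightness.EventualTight :=
  EventualTight_of stub_virginArcTraversalTightBounded stub_boundaryShellTight

/-- The same wiring check against the `SAWRestrictionRigidity` copy of the crux decl. -/
theorem EventualTight_proof_restriction :
    Summit.CriticalPhenomena.SAWScalingLimit.Theses.SAWRestrictionRigidity.EventualTight :=
  EventualTight_of stub_virginArcTraversalTightBounded stub_boundaryShellTight

/-! ### Calibration certificates (sorry-free) -/

/-- **The boundary stub is implied by the crux** (no refutation risk beyond the crux's own): the crux gives per-shell count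
tightness at every shell (`shellCountTight_of_eventualTight`, AB99 Lemma 4.1 "only if", landed), in particular at the
frontier-centred ones. [folklore] -/
theorem boundaryShellTight_of_eventualTight (hT : EventualTight) :
    ∀ (D : DobrushinDomain) (a b : ℝ → Site 2), SAW.IsEndpointApprox D a b →
      ∀ (x : ℂ) (ρ R : ℝ), x ∈ frontier D.carrier → 0 < ρ → 4 * ρ ≤ R → R ≤ 1 → ∀ ε : ℝ, 0 < ε →
        ∃ (k : ℕ) (δ₀ : ℝ), 0 < δ₀ ∧ ∀ δ ∈ Set.Ioc (0 : ℝ) δ₀,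
          SAW.law D.carrier δ (a δ) (b δ)
            {γ | (⟨γ.walk.toCurve (meshPoint δ)⟩ : Curve ℂ).HasTraversals k x ρ R} ≤ ENNReal.ofReal ε := by
  intro D a b hab x ρ R _ hρ h4 _ ε hε
  obtain ⟨δ₀, hδ₀, H⟩ :=
    Summit.CriticalPhenomena.SAWScalingLimit.Theorems.EventualTight.Sketch.shellCountTight_of_eventualTight hT D a b
      hab
  obtain ⟨k, hk⟩ := H x ρ R hρ (by linarith) ε hε
  exact ⟨k, δ₀, hδ₀, hk⟩

/-- **Exact bulk/boundary decomposition of the crux (E-free, rate-free)**: `EventualTight ↔ BulkShellTight ∧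
BoundaryShellTight` — the bulk child stmt-CriticalPhenomena-17588 and the TotalPositivity boundary content are each
NECESSARY and jointly SUFFICIENT. [folklore] -/
theorem eventualTight_iff_bulkShellTight_and_boundaryShellTight :
    EventualTight ↔ (BulkShellTight ∧
      Summit.CriticalPhenomena.SAWScalingLimit.Theorems.TPToTraversalBound.Radial.BoundaryShellTight) :=
  ⟨fun hT => ⟨Theorems.BulkShellTight.Negative.bulkShellTight_of_eventualTight hT,
      boundaryShellTight_of_eventualTight hT⟩, fun h =>
    Theorems.TightOfShellCrossing_proof fun D a b hab =>
      shellCrossing_of_fatShellDecay D a b (fatShellTight_of_bulk_of_boundary h.1 h.2 D a b hab)⟩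

/-- **The old pair implies the new pair**: X2c₁ᵇ and E (`ConfinementPositivity`, stmt-17587) give the crux
(`Theorems.eventualTight_of_virginArcTraversalTightBounded_of_confinementPositivity`, p151500), hence the boundary stub.
So {X2c₁ᵇ, B} is a (weakly) WEAKER sufficient pair than the split of record {X2c₁ᵇ, E}. [folklore] -/
theorem boundaryShellTight_of_virginArcTraversalTightBounded_of_confinementPositivity
    (hXb : ∀ C θ : ℝ, 0 < θ →
      ∃ (k : ℕ) (N₀ : ℝ), 0 < N₀ ∧
        ∀ (H : SimpleGraph (Site 2)) (Λ : Set (Site 2)) (z₀ : ℂ) (N : ℝ) (u c u' c' : Site 2),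
          Λ.Finite → (∀ v ∈ Λ, dist (Site.toComplex v) z₀ ≤ C * N) → N₀ ≤ N →
          (H ≤ zdGraph 2 ∧ (∀ v : Site 2, dist (Site.toComplex v) z₀ ≤ N → v ∈ Λ) ∧
            ∀ v v' : Site 2, dist (Site.toComplex v) z₀ ≤ N + 1 →
              dist (Site.toComplex v') z₀ ≤ N + 1 → (zdGraph 2).Adj v v' → H.Adj v v') →
          (H.Adj u c ∧ u ∉ Λ ∧ c ∈ Λ ∧ dist (Site.toComplex c) z₀ ≤ N ∧
            N < dist (Site.toComplex u) z₀) →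
          (H.Adj u' c' ∧ u' ∉ Λ ∧ c' ∈ Λ ∧ dist (Site.toComplex c') z₀ ≤ N ∧
            N < dist (Site.toComplex u') z₀) →
          ∑' p : {p : {p : H.Walk c c' // p.IsPath ∧ ∀ v ∈ p.support, v ∈ Λ} //
              ∃ ι κ : Fin k → Fin (p.1.support.map Site.toComplex).length, (∀ m, ι m ≤ κ m) ∧
                (∀ m, (dist ((p.1.support.map Site.toComplex).get (ι m)) z₀ ≤ 2 * N / 5 ∧
                    3 * N / 5 ≤ dist ((p.1.support.map Site.toComplex).get (κ m)) z₀) ∨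
                  (3 * N / 5 ≤ dist ((p.1.support.map Site.toComplex).get (ι m)) z₀ ∧
                    dist ((p.1.support.map Site.toComplex).get (κ m)) z₀ ≤ 2 * N / 5)) ∧
                ∀ ⦃m m'⦄, m < m' → κ m ≤ ι m'},
              ENNReal.ofReal (SAW.criticalFugacity ^ p.1.1.length) ≤
            ENNReal.ofReal θ *
              ∑' p : {p : H.Walk c c' // p.IsPath ∧ ∀ v ∈ p.support, v ∈ Λ},
                ENNReal.ofReal (SAW.criticalFugacity ^ p.1.length))
    (hE : ConfinementPositivity) :
    ∀ (D : DobrushinDomain) (a b : ℝ → Site 2), SAW.IsEndpointApprox D a b →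
      ∀ (x : ℂ) (ρ R : ℝ), x ∈ frontier D.carrier → 0 < ρ → 4 * ρ ≤ R → R ≤ 1 → ∀ ε : ℝ, 0 < ε →
        ∃ (k : ℕ) (δ₀ : ℝ), 0 < δ₀ ∧ ∀ δ ∈ Set.Ioc (0 : ℝ) δ₀,
          SAW.law D.carrier δ (a δ) (b δ)
            {γ | (⟨γ.walk.toCurve (meshPoint δ)⟩ : Curve ℂ).HasTraversals k x ρ R} ≤ ENNReal.ofReal ε :=
  boundaryShellTight_of_eventualTight
    (Theorems.eventualTight_of_virginArcTraversalTightBounded_of_confinementPositivity hXb hE)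

end Summit.CriticalPhenomena.SAWScalingLimit.Cruxes.EventualTight.BoundaryBulk
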